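import Mathlib.AlgebraicGeometry.IdealSheaf.Subscheme
import Mathlib.AlgebraicGeometry.Morphisms.Flat
import HarnessLib

/-!
# Flatness of a closed subscheme over an affine base is checked on the charts `Γ(X, U) ⧸ C(U)`

OURS · L1 W4.5b · EL♮(3) `stmt-ResolutionOfSingularities-20148` · J1c brick B2 of DESIGN v2 · counted 0 (res-type-027 g16).
For `p : X ⟶ Spec R` and an ideal sheaf `C` on `X`, `V(C) → Spec R` is flat as soon as every chart ring map
`Γ(Spec R, ⊤) → Γ(X, U) → Γ(X, U) ⧸ C(U)` (`U ⊆ X` affine) is flat: `V(C)` is covered by the `Spec (Γ(X, U) ⧸ C(U))`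
(Mathlib `IdealSheafData.subschemeCover`) and `Flat` is Zariski-local at the source with `Flat (Spec.map φ) ↔ φ.Flat`. [folklore]
-/

noncomputable section

open CategoryTheory CategoryTheory.Limits AlgebraicGeometry TopologicalSpace

namespace Summit.ResolutionOfSingularities.ResolutionOfSingularities.Cruxes.EquisingularLiftNat.Sections

/-- The chart of `V(C) ↪ X → Spec R` on `U`: `Spec (Γ(X,U) ⧸ C(U)) → V(C) → X → Spec R` is
`Spec (Γ(Spec R, ⊤) → Γ(X, U) → Γ(X, U) ⧸ C(U))` followed by the canonical open immersion `Spec Γ(Spec R, ⊤) → Spec R`. [folklore] -/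
theorem subschemeCover_f_subschemeι_comp {X : Scheme.{0}} {R : CommRingCat.{0}} (p : X ⟶ Spec R) (C : X.IdealSheafData)
    (U : X.affineOpens) :
    C.subschemeCover.openCover.f U ≫ C.subschemeι ≫ p =
      Spec.map (CommRingCat.ofHom (Ideal.Quotient.mk (C.ideal U))) ≫ Spec.map (p.appLE ⊤ U le_top) ≫
        (isAffineOpen_top (Spec R)).fromSpec := by
  have h1 : C.subschemeCover.openCover.f U ≫ C.subschemeι = C.glueDataObjι U ≫ (U : X.Opens).ι :=
    C.subschemeCover_map_subschemeι U
  rw [← Category.assoc, h1, Scheme.IdealSheafData.glueDataObjι_ι]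
  erw [Category.assoc, IsAffineOpen.SpecMap_appLE_fromSpec p (isAffineOpen_top (Spec R)) U.2 le_top]
  rfl

/-- **B2. Flatness on charts.** If every chart map `Γ(Spec R, ⊤) → Γ(X, U) ⧸ C(U)` is flat then `V(C) → Spec R` is flat. [folklore] -/
theorem flat_subschemeι_comp_of_forall_affineOpens {X : Scheme.{0}} {R : CommRingCat.{0}} (p : X ⟶ Spec R)
    (C : X.IdealSheafData)
    (h : ∀ U : X.affineOpens, ((Ideal.Quotient.mk (C.ideal U)).comp (p.appLE ⊤ U le_top).hom).Flat) :
    Flat (C.subschemeι ≫ p) := by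
  refine (IsZariskiLocalAtSource.iff_of_openCover (P := @Flat) C.subschemeCover.openCover).mpr fun (U : X.affineOpens) => ?_
  have e := subschemeCover_f_subschemeι_comp p C U
  rw [← Spec.map_comp_assoc] at e
  rw [e]
  haveI : Flat (Spec.map (p.appLE ⊤ U le_top ≫ CommRingCat.ofHom (Ideal.Quotient.mk (C.ideal U)))) := by
    rw [HasRingHomProperty.Spec_iff (P := @Flat)]
    exact h U
  exact MorphismProperty.comp_mem _ _ _ this (inferInstanceAs (Flat (isAffineOpen_top (Spec R)).fromSpec))

/-- Module form of the chart hypothesis: if `Γ(X, U) ⧸ C(U)` is a flat module over `Γ(Spec R, ⊤)` for the algebra structure of the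
chart map, the chart map is flat (definition of `RingHom.Flat`). [folklore] -/
theorem ringHom_flat_iff_module_flat {A B : Type} [CommRing A] [CommRing B] (φ : A →+* B) :
    φ.Flat ↔ @Module.Flat A B _ _ φ.toAlgebra.toModule :=
  Iff.rfl

end Summit.ResolutionOfSingularities.ResolutionOfSingularities.Cruxes.EquisingularLiftNat.Sections

end
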